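import Summits.SmoothPoincare4.SmoothPoincare4.Theorems.DottedCircleRasmussenDcrGapHelperFriendsCarrierVkPartAPushPrelim

/-!
# Helper `helper_friendsCarrier_Vk_partA_framingInput_of_pushOff` (piece 8 of the registered stub
`helper_friendsCarrier_Vk_partA`, line `mk_friends`, skeleton v8) for crux `DcrGap`
(item stmt-SmoothPoincare4-16128, route route-SmoothPoincare4-DottedCircleRasmussen)

**The framing input of Part A from its geometric form (push-offs in tube coordinates).**  Part A of V_k
is proved (`…VkPartAOfInput`) from the FRAMING INPUT: for every `C^∞` transversal pair `(m₀, m₁)` over the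
closed disc and every decomposition `∂_{w₀}|₀ νK(u, ·) = df₁ v + a m₀ + c m₁` along the circle the loop
`a + i c` is null-homotopic in `ℂ ∖ 0`.  This file reduces the framing input to the statement a homological
argument naturally delivers, the PUSH-OFF INPUT: for the affine tube `F(x, w) = f₁ x + w₀ m₀ x + w₁ m₁ x` of the
enlarged disc (injective with `C^∞` inverse `Finv` on `B(0,1+δ) × B(0,η)`, collar inside `D_k°`) and a push-off
`u ↦ νK(u, s e₀)` of the model knot inside the tube, the loop of FIBRE COORDINATES `u ↦ (Finv (νK(u, s e₀))).2`
is null-homotopic in `ℝ² ∖ 0`.  The reduction is differential topology only: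

1. the tube on the prescribed frame (`…VkPartAFrameTube`), its collar pushed into `D_k°` by neatness
   (`exists_neatZone`: the level `G_k ∘ f₁` decreases along the rays just outside the circle), the push-offs
   inside the tube for small `s` (compactness of the circle);
2. the fibre coordinates `Ψ(u, t)` of `νK(u, t e₀)` vanish only at `t = 0` (a point of the tube on the zero
   section is a disc point; disc points of `M_k` are knot points, by the disc clause, neatness and
   injectivity of `νK`), and `∂ₜΨ(u, 0) = (a(u), c(u))` (chain rule through `DFinv ∘ DF = 1` and the
   decomposition of the fibre derivative);
3. the first-order homotopy (`…VkPartAPushHomotopy`) joins `(a, c)` to `Ψ(·, s)`, and the push-off input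
   joins `Ψ(·, s)` to a constant.

* `helper_friendsCarrier_Vk_partA_framingInput_of_pushOff` — the registered statement.

No definitions, no named facts, no `sorry`.

## References

* M. W. Hirsch, *Differential Topology*, GTM 33 (1976), Ch. 4 §5, §6. [Hirsch1976]
* A. A. Kosinski, *Differential Manifolds* (1993), Ch. III (4.1)–(4.2). [Kosinski1993]
-/

-- the prescribed namespace `Summit.<P>.<Sub>.…` duplicates `SmoothPoincare4` (P = Sub)
set_option linter.dupNamespace false
set_option linter.style.longLine false

noncomputable section

open scoped Manifold ContDiff Topology
open Set Function Metric Filter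
open Literature.Topology.FourManifolds Literature.Topology.FourManifolds.MMSW

namespace Summit.SmoothPoincare4.SmoothPoincare4.Theorems.DcrGap.MkFriends

namespace FriendsCarrierVk

variable {k : ℕ} {K₁ : (sphere (0 : EuclideanSpace ℝ (Fin 2)) 1) → EuclideanSpace ℝ (Fin 4)}
  {f₁ : EuclideanSpace ℝ (Fin 2) → EuclideanSpace ℝ (Fin 4)}
  {νK : (sphere (0 : EuclideanSpace ℝ (Fin 2)) 1) × EuclideanSpace ℝ (Fin 2) → EuclideanSpace ℝ (Fin 4)}

/-- **The framing input from the push-off input** (per instance). [cite: Hirsch1976, Ch. 4 §5] -/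
theorem framingInput_of_pushOff (hK : IsModelKnot k K₁) (hf : IsModelSliceDisc k K₁ f₁)
    (hneat : ∀ t : (sphere (0 : EuclideanSpace ℝ (Fin 2)) 1), deriv (fun ρ : ℝ => levelFun k (f₁ (ρ • (t : EuclideanSpace ℝ (Fin 2))))) 1 < 0)
    (hν : ContMDiff ((𝓡 1).prod 𝓘(ℝ, EuclideanSpace ℝ (Fin 2))) 𝓘(ℝ, EuclideanSpace ℝ (Fin 4)) ∞ νK)
    (hνinj : Injective νK)
    (hνimm : ∀ p, Injective (mfderiv ((𝓡 1).prod 𝓘(ℝ, EuclideanSpace ℝ (Fin 2))) 𝓘(ℝ, EuclideanSpace ℝ (Fin 4)) νK p))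
    (hνM : ∀ p, νK p ∈ modelBoundary k) (hν0 : ∀ u : (sphere (0 : EuclideanSpace ℝ (Fin 2)) 1), νK (u, 0) = K₁ u)
    (hgeo : ∀ (m₀ m₁ : EuclideanSpace ℝ (Fin 2) → EuclideanSpace ℝ (Fin 4)) (Finv : EuclideanSpace ℝ (Fin 4) → EuclideanSpace ℝ (Fin 2) × EuclideanSpace ℝ (Fin 2)) (δ η s : ℝ),
      ContDiff ℝ ∞ m₀ → ContDiff ℝ ∞ m₁ → 0 < δ → 0 < η → 0 < s → InjOn f₁ (closedBall 0 (1 + δ)) →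
      (∀ x ∈ ball (0 : EuclideanSpace ℝ (Fin 2)) (1 + 2 * δ), ∀ (e : EuclideanSpace ℝ (Fin 2)) (α β : ℝ), fderiv ℝ f₁ x e + α • m₀ x + β • m₁ x = 0 → e = 0 ∧ α = 0 ∧ β = 0) →
      InjOn (fun q : EuclideanSpace ℝ (Fin 2) × EuclideanSpace ℝ (Fin 2) => f₁ q.1 + q.2 0 • m₀ q.1 + q.2 1 • m₁ q.1) (closedBall (0 : EuclideanSpace ℝ (Fin 2)) (1 + δ) ×ˢ closedBall (0 : EuclideanSpace ℝ (Fin 2)) η) →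
      IsOpen ((fun q : EuclideanSpace ℝ (Fin 2) × EuclideanSpace ℝ (Fin 2) => f₁ q.1 + q.2 0 • m₀ q.1 + q.2 1 • m₁ q.1) '' (ball (0 : EuclideanSpace ℝ (Fin 2)) (1 + δ) ×ˢ ball (0 : EuclideanSpace ℝ (Fin 2)) η)) →
      ContDiffOn ℝ ∞ Finv ((fun q : EuclideanSpace ℝ (Fin 2) × EuclideanSpace ℝ (Fin 2) => f₁ q.1 + q.2 0 • m₀ q.1 + q.2 1 • m₁ q.1) '' (ball (0 : EuclideanSpace ℝ (Fin 2)) (1 + δ) ×ˢ ball (0 : EuclideanSpace ℝ (Fin 2)) η)) →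
      (∀ q ∈ ball (0 : EuclideanSpace ℝ (Fin 2)) (1 + δ) ×ˢ ball (0 : EuclideanSpace ℝ (Fin 2)) η, Finv (f₁ q.1 + q.2 0 • m₀ q.1 + q.2 1 • m₁ q.1) = q) →
      (∀ (u : (sphere (0 : EuclideanSpace ℝ (Fin 2)) 1)) (ρ : ℝ), 1 < ρ → ρ ≤ 1 + δ → levelFun k (f₁ (ρ • (u : EuclideanSpace ℝ (Fin 2)))) < 1) →
      (∀ (u : (sphere (0 : EuclideanSpace ℝ (Fin 2)) 1)) (t : ℝ), 0 < t → t ≤ s → νK (u, t • EuclideanSpace.single 0 1) ∈ (fun q : EuclideanSpace ℝ (Fin 2) × EuclideanSpace ℝ (Fin 2) => f₁ q.1 + q.2 0 • m₀ q.1 + q.2 1 • m₁ q.1) '' (ball (0 : EuclideanSpace ℝ (Fin 2)) (1 + δ) ×ˢ ball (0 : EuclideanSpace ℝ (Fin 2)) η)) →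
      ∃ G : unitInterval × (sphere (0 : EuclideanSpace ℝ (Fin 2)) 1) → EuclideanSpace ℝ (Fin 2), Continuous G ∧ (∀ p, G p ≠ 0) ∧
        (∀ u, G (0, u) = (Finv (νK (u, s • EuclideanSpace.single 0 1))).2) ∧ ∃ e : EuclideanSpace ℝ (Fin 2), ∀ u, G (1, u) = e)
    (m₀ m₁ : EuclideanSpace ℝ (Fin 2) → EuclideanSpace ℝ (Fin 4)) (a c : (sphere (0 : EuclideanSpace ℝ (Fin 2)) 1) → ℝ)
    (v : (sphere (0 : EuclideanSpace ℝ (Fin 2)) 1) → EuclideanSpace ℝ (Fin 2)) (hm₀ : ContDiff ℝ ∞ m₀) (hm₁ : ContDiff ℝ ∞ m₁)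
    (htr : ∀ x ∈ closedBall (0 : EuclideanSpace ℝ (Fin 2)) 1, ∀ (e : EuclideanSpace ℝ (Fin 2)) (α β : ℝ), fderiv ℝ f₁ x e + α • m₀ x + β • m₁ x = 0 → e = 0 ∧ α = 0 ∧ β = 0)
    (ha : Continuous a) (hc : Continuous c)
    (hdec : ∀ u : (sphere (0 : EuclideanSpace ℝ (Fin 2)) 1), fderiv ℝ (fun w : EuclideanSpace ℝ (Fin 2) => νK (u, w)) 0 (EuclideanSpace.single 0 1) = fderiv ℝ f₁ u (v u) + a u • m₀ u + c u • m₁ u) :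
    ∃ H : unitInterval × (sphere (0 : EuclideanSpace ℝ (Fin 2)) 1) → ℂ, Continuous H ∧ (∀ p, H p ≠ 0) ∧
      (∀ u, H (0, u) = (a u : ℂ) + (c u : ℂ) * Complex.I) ∧ ∃ z : ℂ, ∀ u, H (1, u) = z := by
  have hfs : ContDiff ℝ ∞ f₁ := contMDiff_iff_contDiff.1 hf.1
  ------------------------------------------------------------------
  -- the tube on the frame, with collar inside `D_k°`
  ------------------------------------------------------------------
  obtain ⟨δ₀, η, Finv, hδ₀, hη, hinjf, -, htr2, -, hinjF, hopen, hFinvs, hleft⟩ :=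
    helper_friendsCarrier_Vk_partA_frameTube f₁ m₀ m₁ hfs hf.2.1 hm₀ hm₁ htr
  obtain ⟨δc, hδc, hcol⟩ := exists_collar_level_lt hK hf hneat
  set F : EuclideanSpace ℝ (Fin 2) × EuclideanSpace ℝ (Fin 2) → EuclideanSpace ℝ (Fin 4) :=
    fun q => f₁ q.1 + q.2 0 • m₀ q.1 + q.2 1 • m₁ q.1 with hFdef
  -- shrink `δ` below the collar width
  set δ : ℝ := min δ₀ δc / 2 with hδdef
  have hδ : 0 < δ := by rw [hδdef]; have := lt_min hδ₀ hδc; linarith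
  have hδδ₀ : δ ≤ δ₀ := by rw [hδdef]; have := min_le_left δ₀ δc; linarith [hδ₀]
  have hδδc : δ ≤ δc := by rw [hδdef]; have := min_le_right δ₀ δc; linarith [hδc]
  set dom₀ : Set (EuclideanSpace ℝ (Fin 2) × EuclideanSpace ℝ (Fin 2)) := ball (0 : EuclideanSpace ℝ (Fin 2)) (1 + δ₀) ×ˢ ball (0 : EuclideanSpace ℝ (Fin 2)) η with hdom₀
  set dom : Set (EuclideanSpace ℝ (Fin 2) × EuclideanSpace ℝ (Fin 2)) := ball (0 : EuclideanSpace ℝ (Fin 2)) (1 + δ) ×ˢ ball (0 : EuclideanSpace ℝ (Fin 2)) η with hdom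
  have hdomsub : dom ⊆ dom₀ := prod_mono (ball_subset_ball (by linarith)) Subset.rfl
  have hdomo : IsOpen dom := isOpen_ball.prod isOpen_ball
  -- the restricted tube and its clauses
  have himage : F '' dom = F '' dom₀ ∩ Finv ⁻¹' dom := by
    ext y; constructor
    · rintro ⟨q, hq, rfl⟩
      exact ⟨⟨q, hdomsub hq, rfl⟩, by show Finv (F q) ∈ dom; rw [hleft q (hdomsub hq)]; exact hq⟩
    · rintro ⟨⟨q, hq, rfl⟩, hq'⟩
      have : Finv (F q) = q := hleft q hq
      rw [mem_preimage, this] at hq'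
      exact ⟨q, hq', rfl⟩
  have hopen' : IsOpen (F '' dom) := by
    rw [himage]; exact hFinvs.continuousOn.isOpen_inter_preimage hopen hdomo
  have hFinvs' : ContDiffOn ℝ ∞ Finv (F '' dom) := hFinvs.mono (image_mono hdomsub)
  have hleft' : ∀ q ∈ dom, Finv (F q) = q := fun q hq => hleft q (hdomsub hq)
  have hinjF' : InjOn F (closedBall (0 : EuclideanSpace ℝ (Fin 2)) (1 + δ) ×ˢ closedBall (0 : EuclideanSpace ℝ (Fin 2)) η) :=
    hinjF.mono (prod_mono (closedBall_subset_closedBall (by linarith)) Subset.rfl)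
  have hinjf' : InjOn f₁ (closedBall 0 (1 + δ)) := hinjf.mono (closedBall_subset_closedBall (by linarith))
  have htr2' : ∀ x ∈ ball (0 : EuclideanSpace ℝ (Fin 2)) (1 + 2 * δ), ∀ (e : EuclideanSpace ℝ (Fin 2)) (α β : ℝ),
      fderiv ℝ f₁ x e + α • m₀ x + β • m₁ x = 0 → e = 0 ∧ α = 0 ∧ β = 0 := fun x hx => htr2 x (ball_subset_ball (by linarith) hx)
  have hcol' : ∀ (u : (sphere (0 : EuclideanSpace ℝ (Fin 2)) 1)) (ρ : ℝ), 1 < ρ → ρ ≤ 1 + δ →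
      levelFun k (f₁ (ρ • (u : EuclideanSpace ℝ (Fin 2)))) < 1 := fun u ρ h1 h2 => hcol u ρ h1 (by linarith)
  ------------------------------------------------------------------
  -- push-offs inside the tube
  ------------------------------------------------------------------
  have hKT : ∀ u : (sphere (0 : EuclideanSpace ℝ (Fin 2)) 1), K₁ u ∈ F '' dom := fun u =>
    ⟨((u : EuclideanSpace ℝ (Fin 2)), 0), ⟨mem_ball_zero_iff.2 (by rw [norm_eq_of_mem_sphere u]; linarith), by simpa using hη⟩,
      by simp [hFdef, hf.2.2.2.2 u]⟩
  obtain ⟨s, hs, hsT⟩ := exists_pushOff_mem hν.continuous hν0 hopen' hKT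
  have hsT' : ∀ (u : (sphere (0 : EuclideanSpace ℝ (Fin 2)) 1)) (t : ℝ), |t| ≤ s → νK (u, t • EuclideanSpace.single 0 1) ∈ F '' dom :=
    fun u t ht => hsT u _ (by rw [norm_smul, PiLp.norm_single, norm_one, mul_one, Real.norm_eq_abs]; exact ht)
  ------------------------------------------------------------------
  -- the push-off input: the fibre loop at time `s` is null-homotopic
  ------------------------------------------------------------------
  obtain ⟨G₁, hG₁c, hG₁0, hG₁s, e₁, hG₁e⟩ := hgeo m₀ m₁ Finv δ η s hm₀ hm₁ hδ hη hs hinjf' htr2' hinjF' hopen' hFinvs' hleft' hcol'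
    (fun u t ht hts => hsT' u t (by rw [abs_of_pos ht]; exact hts))
  ------------------------------------------------------------------
  -- the fibre coordinates of the push-offs and their first-order term
  ------------------------------------------------------------------
  let u₀ : (sphere (0 : EuclideanSpace ℝ (Fin 2)) 1) := ⟨EuclideanSpace.single 0 1, by simp⟩
  set Ψ : EuclideanSpace ℝ (Fin 2) × ℝ → EuclideanSpace ℝ (Fin 2) := fun p =>
    (Finv (νK (radialProjection u₀ p.1, p.2 • EuclideanSpace.single 0 1))).2 with hΨdef
  set Lf : EuclideanSpace ℝ (Fin 2) → EuclideanSpace ℝ (Fin 2) := fun y =>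
    !₂[a (radialProjection u₀ y), c (radialProjection u₀ y)] with hLfdef
  -- smoothness of `Ψ` at the points of `S × [-s, s]`
  have hΨs : ∀ u ∈ sphere (0 : EuclideanSpace ℝ (Fin 2)) 1, ∀ t ∈ Icc 0 s, ContDiffAt ℝ 1 Ψ (u, t) := by
    intro u hu t ht
    have hu0 : u ≠ 0 := by rintro rfl; simp at hu
    have h1 : ContMDiffAt 𝓘(ℝ, EuclideanSpace ℝ (Fin 2) × ℝ) ((𝓡 1).prod 𝓘(ℝ, EuclideanSpace ℝ (Fin 2))) ∞
        (fun p : EuclideanSpace ℝ (Fin 2) × ℝ => (radialProjection u₀ p.1, p.2 • EuclideanSpace.single (0 : Fin 2) (1 : ℝ))) (u, t) :=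
      ((contMDiffAt_radialProjection u₀ hu0).comp (u, t) contDiffAt_fst.contMDiffAt).prodMk
        ((contDiff_snd.smul contDiff_const).contDiffAt.contMDiffAt)
    have h2 : ContDiffAt ℝ ∞ (fun p : EuclideanSpace ℝ (Fin 2) × ℝ => νK (radialProjection u₀ p.1, p.2 • EuclideanSpace.single (0 : Fin 2) (1 : ℝ))) (u, t) :=
      contMDiffAt_iff_contDiffAt.1 ((hν _).comp (u, t) h1)
    have hmem : νK (radialProjection u₀ u, t • EuclideanSpace.single (0 : Fin 2) (1 : ℝ)) ∈ F '' dom :=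
      hsT' _ t (by rw [abs_of_nonneg ht.1]; exact ht.2)
    have h3 : ContDiffAt ℝ ∞ Finv (νK (radialProjection u₀ u, t • EuclideanSpace.single (0 : Fin 2) (1 : ℝ))) :=
      hFinvs'.contDiffAt (hopen'.mem_nhds hmem)
    exact ((contDiffAt_snd.comp _ (h3.comp (u, t) h2)).of_le (by exact_mod_cast le_top))
  -- `Ψ(u, 0) = 0`
  have hΨ0 : ∀ u ∈ sphere (0 : EuclideanSpace ℝ (Fin 2)) 1, Ψ (u, 0) = 0 := by
    intro u hu
    let u' : (sphere (0 : EuclideanSpace ℝ (Fin 2)) 1) := ⟨u, hu⟩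
    have hq : ((u, (0 : EuclideanSpace ℝ (Fin 2))) : EuclideanSpace ℝ (Fin 2) × EuclideanSpace ℝ (Fin 2)) ∈ dom :=
      ⟨mem_ball_zero_iff.2 (by rw [show ‖u‖ = 1 by simpa using hu]; linarith), by simpa using hη⟩
    have hrp : radialProjection u₀ u = u' := by
      have : (u : EuclideanSpace ℝ (Fin 2)) = (u' : EuclideanSpace ℝ (Fin 2)) := rfl
      rw [this, radialProjection_coe_sphere]
    simp only [hΨdef, zero_smul, hrp, hν0, ← hf.2.2.2.2 u']
    have : f₁ (u' : EuclideanSpace ℝ (Fin 2)) = F (u, 0) := by simp [hFdef, u']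
    rw [this, hleft' _ hq]
  -- `∂ₜΨ(u, 0) = (a u, c u)`
  have hL : ∀ u ∈ sphere (0 : EuclideanSpace ℝ (Fin 2)) 1, fderiv ℝ Ψ (u, 0) ((0 : EuclideanSpace ℝ (Fin 2)), (1 : ℝ)) = Lf u := by
    intro u hu
    let u' : (sphere (0 : EuclideanSpace ℝ (Fin 2)) 1) := ⟨u, hu⟩
    have hrp : radialProjection u₀ u = u' := by
      have : (u : EuclideanSpace ℝ (Fin 2)) = (u' : EuclideanSpace ℝ (Fin 2)) := rfl
      rw [this, radialProjection_coe_sphere]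
    -- the `t`-derivative through the curve `t ↦ (u, t)`
    have hΨd : DifferentiableAt ℝ Ψ (u, 0) := (hΨs u hu 0 ⟨le_rfl, hs.le⟩).differentiableAt one_ne_zero
    have hcurve : HasDerivAt (fun t : ℝ => ((u, t) : EuclideanSpace ℝ (Fin 2) × ℝ)) ((0 : EuclideanSpace ℝ (Fin 2)), (1 : ℝ)) 0 := by
      have := (hasDerivAt_const (0 : ℝ) u).prodMk (hasDerivAt_id (0 : ℝ))
      simpa using this
    have hd1 : HasDerivAt (fun t : ℝ => Ψ (u, t)) (fderiv ℝ Ψ (u, 0) ((0 : EuclideanSpace ℝ (Fin 2)), (1 : ℝ))) 0 :=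
      hΨd.hasFDerivAt.comp_hasDerivAt 0 hcurve
    -- the same derivative by the chain rule `snd ∘ DFinv ∘ (fibre derivative of νK)`
    have hb : HasDerivAt (fun t : ℝ => νK (u', t • EuclideanSpace.single (0 : Fin 2) (1 : ℝ)))
        (fderiv ℝ (fun w : EuclideanSpace ℝ (Fin 2) => νK (u', w)) 0 (EuclideanSpace.single 0 1)) 0 := by
      have hT := contDiff_angleTube hν
      obtain ⟨θ, hθ⟩ := circlePoint_surjective u'
      have hw : DifferentiableAt ℝ (fun w : EuclideanSpace ℝ (Fin 2) => νK (u', w)) 0 := by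
        rw [← hθ]
        have hj : ContDiff ℝ ∞ (fun w : EuclideanSpace ℝ (Fin 2) => ((θ, w) : ℝ × EuclideanSpace ℝ (Fin 2))) := by fun_prop
        exact ((hT.comp hj).differentiable (by simp)) 0
      have hline : HasDerivAt (fun t : ℝ => t • EuclideanSpace.single (0 : Fin 2) (1 : ℝ)) (EuclideanSpace.single (0 : Fin 2) (1 : ℝ)) 0 := by
        simpa using (hasDerivAt_id (0 : ℝ)).smul_const (EuclideanSpace.single (0 : Fin 2) (1 : ℝ))
      exact hw.hasFDerivAt.comp_hasDerivAt_of_eq 0 hline (by simp)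
    have hK0 : νK (u', 0) = f₁ u := by rw [hν0, ← hf.2.2.2.2 u']
    have hFinvd : HasFDerivAt Finv (fderiv ℝ Finv (f₁ u)) (νK (u', (0 : ℝ) • EuclideanSpace.single (0 : Fin 2) (1 : ℝ))) := by
      rw [zero_smul, hK0]
      have hmem : f₁ u ∈ F '' dom := by rw [hf.2.2.2.2 u']; exact hKT u'
      exact ((hFinvs'.contDiffAt (hopen'.mem_nhds hmem)).differentiableAt (by simp)).hasFDerivAt
    have hd2 : HasDerivAt (fun t : ℝ => Ψ (u, t))
        ((fderiv ℝ Finv (f₁ u) (fderiv ℝ (fun w : EuclideanSpace ℝ (Fin 2) => νK (u', w)) 0 (EuclideanSpace.single 0 1))).2) 0 := by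
      have h := (hFinvd.comp_hasDerivAt 0 hb)
      have h2 : HasDerivAt (fun t : ℝ => (Finv (νK (u', t • EuclideanSpace.single (0 : Fin 2) (1 : ℝ)))).2)
          ((fderiv ℝ Finv (f₁ u) (fderiv ℝ (fun w : EuclideanSpace ℝ (Fin 2) => νK (u', w)) 0 (EuclideanSpace.single 0 1))).2) 0 :=
        (hasFDerivAt_snd (𝕜 := ℝ) (E := EuclideanSpace ℝ (Fin 2)) (F := EuclideanSpace ℝ (Fin 2))).comp_hasDerivAt 0 h
      have heq : (fun t : ℝ => Ψ (u, t)) = fun t : ℝ => (Finv (νK (u', t • EuclideanSpace.single (0 : Fin 2) (1 : ℝ)))).2 := by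
        funext t; simp only [hΨdef, hrp]
      rw [heq]; exact h2
    have := hd1.unique hd2
    rw [this, hdec u', fderiv_inv_apply_frame hη hfs hm₀ hm₁ hopen' hFinvs' hleft'
      (mem_ball_zero_iff.2 (by rw [show ‖u‖ = 1 by simpa using hu]; linarith)) (v u') (a u') (c u')]
    simp only [hLfdef, hrp]
  -- `(a u, c u) ≠ 0` by transversality at the circle
  obtain ⟨htrb, -⟩ := helper_friendsCarrier_Vk_partA_boundaryFrame k K₁ f₁ νK hf hneat hν hνimm hνM hν0
  have hL0 : ∀ u ∈ sphere (0 : EuclideanSpace ℝ (Fin 2)) 1, Lf u ≠ 0 := by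
    intro u hu h0
    let u' : (sphere (0 : EuclideanSpace ℝ (Fin 2)) 1) := ⟨u, hu⟩
    have hrp : radialProjection u₀ u = u' := by
      have : (u : EuclideanSpace ℝ (Fin 2)) = (u' : EuclideanSpace ℝ (Fin 2)) := rfl
      rw [this, radialProjection_coe_sphere]
    simp only [hLfdef, hrp] at h0
    have ha0 : a u' = 0 := by simpa using congrArg (fun z : EuclideanSpace ℝ (Fin 2) => z 0) h0
    have hc0 : c u' = 0 := by simpa using congrArg (fun z : EuclideanSpace ℝ (Fin 2) => z 1) h0
    have h := hdec u'
    rw [ha0, hc0, zero_smul, zero_smul, add_zero, add_zero] at h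
    have := htrb u' (-(v u')) 1 0 (by rw [map_neg, h, one_smul, zero_smul, add_zero, neg_add_cancel])
    exact one_ne_zero this.2.1
  have hLc : ContinuousOn Lf (sphere 0 1) := by
    have hrc : ContinuousOn (radialProjection u₀) (sphere (0 : EuclideanSpace ℝ (Fin 2)) 1) :=
      (continuousOn_radialProjection u₀).mono fun x hx => by
        show x ≠ 0; rintro rfl; simp at hx
    have hac : ContinuousOn (fun y => a (radialProjection u₀ y)) (sphere (0 : EuclideanSpace ℝ (Fin 2)) 1) := ha.comp_continuousOn hrc
    have hcc : ContinuousOn (fun y => c (radialProjection u₀ y)) (sphere (0 : EuclideanSpace ℝ (Fin 2)) 1) := hc.comp_continuousOn hrc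
    have hLf' : Lf = fun y => a (radialProjection u₀ y) • EuclideanSpace.single (0 : Fin 2) (1 : ℝ) +
        c (radialProjection u₀ y) • EuclideanSpace.single (1 : Fin 2) (1 : ℝ) := by
      funext y; ext i; fin_cases i <;> simp [hLfdef]
    rw [hLf']
    exact (hac.smul continuousOn_const).add (hcc.smul continuousOn_const)
  -- `Ψ(u, t) ≠ 0` for `0 < t ≤ s`
  have hne : ∀ u ∈ sphere (0 : EuclideanSpace ℝ (Fin 2)) 1, ∀ t : ℝ, 0 < t → t ≤ s → Ψ (u, t) ≠ 0 := by
    intro u hu t ht hts hzero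
    let u' : (sphere (0 : EuclideanSpace ℝ (Fin 2)) 1) := ⟨u, hu⟩
    have hrp : radialProjection u₀ u = u' := by
      have : (u : EuclideanSpace ℝ (Fin 2)) = (u' : EuclideanSpace ℝ (Fin 2)) := rfl
      rw [this, radialProjection_coe_sphere]
    have hmem : νK (u', t • EuclideanSpace.single (0 : Fin 2) (1 : ℝ)) ∈ F '' dom := hsT' u' t (by rw [abs_of_pos ht]; exact hts)
    obtain ⟨q, hq, hqF⟩ := hmem
    have hFq : Finv (νK (u', t • EuclideanSpace.single (0 : Fin 2) (1 : ℝ))) = q := by rw [← hqF]; exact hleft' q hq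
    simp only [hΨdef, hrp] at hzero
    rw [hFq] at hzero
    -- so `νK(u, t e₀) = F(q.1, 0) = f₁ q.1`
    have hval : νK (u', t • EuclideanSpace.single (0 : Fin 2) (1 : ℝ)) = f₁ q.1 := by
      rw [← hqF]; simp [hFdef, hzero]
    have := eq_of_apply_eq_disc hf hνinj hνM hν0 hcol (lt_of_lt_of_le (mem_ball_zero_iff.1 hq.1) (by linarith)) hval
    have h1 := congrArg (fun z : EuclideanSpace ℝ (Fin 2) => z 0) this
    simp at h1
    exact ht.ne' h1
  ------------------------------------------------------------------
  -- the two homotopies and their concatenation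
  ------------------------------------------------------------------
  obtain ⟨G₂, hG₂c, hG₂0, hG₂L, hG₂s⟩ := helper_friendsCarrier_Vk_partA_pushHomotopy Ψ Lf s hs hΨs hΨ0 hL hL0 hLc hne
  -- maps into the punctured plane
  let Y := {w : EuclideanSpace ℝ (Fin 2) // w ≠ 0}
  let g₀ : C((sphere (0 : EuclideanSpace ℝ (Fin 2)) 1), Y) :=
    ⟨fun u => ⟨G₂ (0, u), hG₂0 _⟩, (hG₂c.comp (continuous_const.prodMk continuous_id)).subtype_mk _⟩
  let g₁ : C((sphere (0 : EuclideanSpace ℝ (Fin 2)) 1), Y) :=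
    ⟨fun u => ⟨G₂ (1, u), hG₂0 _⟩, (hG₂c.comp (continuous_const.prodMk continuous_id)).subtype_mk _⟩
  let g₂ : C((sphere (0 : EuclideanSpace ℝ (Fin 2)) 1), Y) :=
    ⟨fun _ => ⟨e₁, by rw [← hG₁e u₀]; exact hG₁0 _⟩, continuous_const⟩
  have H₁ : ContinuousMap.Homotopy g₀ g₁ :=
    { toFun := fun p => ⟨G₂ p, hG₂0 p⟩
      continuous_toFun := hG₂c.subtype_mk _
      map_zero_left := fun u => rfl
      map_one_left := fun u => rfl }
  have hmatch : ∀ u : (sphere (0 : EuclideanSpace ℝ (Fin 2)) 1), G₁ (0, u) = G₂ (1, u) := fun u => by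
    rw [hG₁s, hG₂s]; simp only [hΨdef, radialProjection_coe_sphere]
  have H₂ : ContinuousMap.Homotopy g₁ g₂ :=
    { toFun := fun p => ⟨G₁ p, hG₁0 p⟩
      continuous_toFun := hG₁c.subtype_mk _
      map_zero_left := fun u => Subtype.ext (hmatch u)
      map_one_left := fun u => Subtype.ext (hG₁e u) }
  let H := H₁.trans H₂
  -- to the complex plane
  let toC : EuclideanSpace ℝ (Fin 2) → ℂ := fun w => ((w 0 : ℝ) : ℂ) + ((w 1 : ℝ) : ℂ) * Complex.I
  have htoC : Continuous toC := by fun_prop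
  have htoC0 : ∀ w : EuclideanSpace ℝ (Fin 2), toC w = 0 → w = 0 := fun w hw => by
    have h0 := congrArg Complex.re hw
    have h1 := congrArg Complex.im hw
    simp [toC] at h0 h1
    ext i; fin_cases i
    · simpa using h0
    · simpa using h1
  refine ⟨fun p => toC ((H p : Y) : EuclideanSpace ℝ (Fin 2)), htoC.comp (continuous_subtype_val.comp H.continuous),
    fun p hp => (H p).2 (htoC0 _ hp), fun u => ?_, ⟨toC e₁, fun u => ?_⟩⟩
  · show toC ((H (0, u) : Y) : EuclideanSpace ℝ (Fin 2)) = _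
    rw [H.apply_zero]
    show toC (G₂ (0, u)) = _
    rw [hG₂L]
    simp [toC, hLfdef, radialProjection_coe_sphere]
  · show toC ((H (1, u) : Y) : EuclideanSpace ℝ (Fin 2)) = _
    rw [H.apply_one]
    rfl

end FriendsCarrierVk

open FriendsCarrierVk in
/-- **Helper `helper_friendsCarrier_Vk_partA_framingInput_of_pushOff`** (piece of `helper_friendsCarrier_Vk_partA`:
the framing input from the push-off input).  For a neat model slice disc `f₁` of the model knot `K₁` and a tube
`νK : 𝕊¹ × ℝ² → M_k` of `K₁` (`C^∞` injective immersion, `νK(u, 0) = K₁ u`): IF for every `C^∞` pair `(m₀, m₁)`,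
every `C^∞` left inverse `Finv` of the affine tube `F(x, w) = f₁ x + w₀ m₀ x + w₁ m₁ x` on the open image of
`B(0, 1 + δ) × B(0, η)` (with `F` injective on the closed product, `f₁` injective on `B̄(0, 1 + δ)` and
transversal to `(m₀, m₁)` on `B(0, 1 + 2δ)`, the collar `1 < ρ ≤ 1 + δ` at level `< 1`) and every `s > 0` with
the push-offs `νK(u, t e₀)`, `0 < t ≤ s`, inside the tube, the fibre-coordinate loop `u ↦ (Finv (νK(u, s e₀))).2`
is freely null-homotopic in `ℝ² ∖ 0`, THEN the framing input holds: for every `C^∞` pair `(m₀, m₁)` transversal to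
`f₁` over the closed unit disc and every decomposition `∂_{w₀}|₀ νK(u, ·) = df₁ v + a m₀ + c m₁` along the circle
with continuous `a, c`, the loop `a + i c` is freely null-homotopic in `ℂ ∖ 0`. [cite: Hirsch1976, Ch. 4 §5] -/
theorem helper_friendsCarrier_Vk_partA_framingInput_of_pushOff : ∀ (k : ℕ) (K₁ : (sphere (0 : EuclideanSpace ℝ (Fin 2)) 1) → EuclideanSpace ℝ (Fin 4)) (f₁ : EuclideanSpace ℝ (Fin 2) → EuclideanSpace ℝ (Fin 4)) (νK : (sphere (0 : EuclideanSpace ℝ (Fin 2)) 1) × EuclideanSpace ℝ (Fin 2) → EuclideanSpace ℝ (Fin 4)), IsModelKnot k K₁ → IsModelSliceDisc k K₁ f₁ → (∀ t : (sphere (0 : EuclideanSpace ℝ (Fin 2)) 1), deriv (fun ρ : ℝ => levelFun k (f₁ (ρ • (t : EuclideanSpace ℝ (Fin 2))))) 1 < 0) → ContMDiff ((𝓡 1).prod 𝓘(ℝ, EuclideanSpace ℝ (Fin 2))) 𝓘(ℝ, EuclideanSpace ℝ (Fin 4)) ∞ νK → Injective νK → (∀ p, Injective (mfderiv ((𝓡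 1).prod 𝓘(ℝ, EuclideanSpace ℝ (Fin 2))) 𝓘(ℝ, EuclideanSpace ℝ (Fin 4)) νK p)) → (∀ p, νK p ∈ modelBoundary k) → (∀ u : (sphere (0 : EuclideanSpace ℝ (Fin 2)) 1), νK (u, 0) = K₁ u) → (∀ (m₀ m₁ : EuclideanSpace ℝ (Fin 2) → EuclideanSpace ℝ (Fin 4)) (Finv : EuclideanSpace ℝ (Fin 4) → EuclideanSpace ℝ (Fin 2) × EuclideanSpace ℝ (Fin 2)) (δ η s : ℝ), ContDiff ℝ ∞ m₀ → ContDiff ℝ ∞ m₁ → 0 < δ → 0 < η → 0 < s → InjOn f₁ (closedBall 0 (1 + δ)) → (∀ x ∈ ball (0 : EuclideanSpace ℝ (Fin 2)) (1 + 2 * δ), ∀ (e : EuclideanSpace ℝ (Fin 2)) (α β : ℝ), fderiv ℝ f₁ x e + α • m₀ x + β • m₁ x = 0 → e = 0 ∧ α = 0 ∧ β = 0) → InjOn (fun q : EuclideanSpace ℝ (Fin 2) × EuclideanSpace ℝ (Fin 2) => f₁ q.1 + q.2 0 • m₀ q.1 + q.2 1 • m₁ q.1) (closedBall (0 : EuclideanSpace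 ℝ (Fin 2)) (1 + δ) ×ˢ closedBall (0 : EuclideanSpace ℝ (Fin 2)) η) → IsOpen ((fun q : EuclideanSpace ℝ (Fin 2) × EuclideanSpace ℝ (Fin 2) => f₁ q.1 + q.2 0 • m₀ q.1 + q.2 1 • m₁ q.1) '' (ball (0 : EuclideanSpace ℝ (Fin 2)) (1 + δ) ×ˢ ball (0 : EuclideanSpace ℝ (Fin 2)) η)) → ContDiffOn ℝ ∞ Finv ((fun q : EuclideanSpace ℝ (Fin 2) × EuclideanSpace ℝ (Fin 2) => f₁ q.1 + q.2 0 • m₀ q.1 + q.2 1 • m₁ q.1) '' (ball (0 : EuclideanSpace ℝ (Fin 2)) (1 + δ) ×ˢ ball (0 : EuclideanSpace ℝ (Fin 2)) η)) → (∀ q ∈ ball (0 : EuclideanSpace ℝ (Fin 2)) (1 + δ) ×ˢ ball (0 : EuclideanSpace ℝ (Fin 2)) η, Finv (f₁ q.1 + q.2 0 • m₀ q.1 + q.2 1 • m₁ q.1) = q) → (∀ (u : (sphere (0 : EuclideanSpace ℝ (Fin 2)) 1)) (ρ : ℝ), 1 < ρ → ρ ≤ 1 + δ → levelFun k (f₁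 (ρ • (u : EuclideanSpace ℝ (Fin 2)))) < 1) → (∀ (u : (sphere (0 : EuclideanSpace ℝ (Fin 2)) 1)) (t : ℝ), 0 < t → t ≤ s → νK (u, t • EuclideanSpace.single 0 1) ∈ (fun q : EuclideanSpace ℝ (Fin 2) × EuclideanSpace ℝ (Fin 2) => f₁ q.1 + q.2 0 • m₀ q.1 + q.2 1 • m₁ q.1) '' (ball (0 : EuclideanSpace ℝ (Fin 2)) (1 + δ) ×ˢ ball (0 : EuclideanSpace ℝ (Fin 2)) η)) → ∃ G : unitInterval × (sphere (0 : EuclideanSpace ℝ (Fin 2)) 1) → EuclideanSpace ℝ (Fin 2), Continuous G ∧ (∀ p, G p ≠ 0) ∧ (∀ u, G (0, u) = (Finv (νK (u, s • EuclideanSpace.single 0 1))).2) ∧ ∃ e : EuclideanSpace ℝ (Fin 2), ∀ u, G (1, u) = e) → ∀ (m₀ m₁ : EuclideanSpace ℝ (Fin 2) → EuclideanSpace ℝ (Fin 4)) (a c : (sphere (0 : EuclideanSpace ℝ (Fin 2)) 1) → ℝ) (v : (sphere (0 : EuclideanSpace ℝ (Fin 2)) 1) → EuclideanSpace ℝ (Fin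 2)), ContDiff ℝ ∞ m₀ → ContDiff ℝ ∞ m₁ → (∀ x ∈ closedBall (0 : EuclideanSpace ℝ (Fin 2)) 1, ∀ (e : EuclideanSpace ℝ (Fin 2)) (α β : ℝ), fderiv ℝ f₁ x e + α • m₀ x + β • m₁ x = 0 → e = 0 ∧ α = 0 ∧ β = 0) → Continuous a → Continuous c → (∀ u : (sphere (0 : EuclideanSpace ℝ (Fin 2)) 1), fderiv ℝ (fun w : EuclideanSpace ℝ (Fin 2) => νK (u, w)) 0 (EuclideanSpace.single 0 1) = fderiv ℝ f₁ u (v u) + a u • m₀ u + c u • m₁ u) → ∃ H : unitInterval × (sphere (0 : EuclideanSpace ℝ (Fin 2)) 1) → ℂ, Continuous H ∧ (∀ p, H p ≠ 0) ∧ (∀ u, H (0, u) = (a u : ℂ) + (c u : ℂ) * Complex.I) ∧ ∃ z : ℂ, ∀ u, H (1, u) = z := by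
  intro k K₁ f₁ νK hK hf hneat hν hνinj hνimm hνM hν0 hgeo m₀ m₁ a c v hm₀ hm₁ htr ha hc hdec
  exact framingInput_of_pushOff hK hf hneat hν hνinj hνimm hνM hν0 hgeo m₀ m₁ a c v hm₀ hm₁ htr ha hc hdec


end Summit.SmoothPoincare4.SmoothPoincare4.Theorems.DcrGap.MkFriends

end
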